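import Summits.BirchSwinnertonDyer.Rank1Residual.P2.PrintCf2SplitBadTwoDeltaReadCore
import HarnessLib

set_option autoImplicit false

/-!
# R219-INST₂-CORE (δ) CLOSED IN KERNEL up to «the seam modulo level n»: ★★ `delta_read₂` (P47's `RamifiedReading` with
# `Γ = (ℤ/2^{n+1})ˣ`, `e = refl`, `s = 2^n`, `γ₀ = 1 + 2^n`, `κ = ½`, `V₂ = −c_β`), the consumer's character sum `delta_charSum`,
# and what remains of (γ′) — TYPED (`SeamModLevel` ⟸ `ValueIdentification` ⟸ `PacketMatching`)

Cell `bsd-print-cf2`, discharge-interface typer `bsd-print-cf2-ty2` g46 (literature-prover seat; Summits-side helpers in the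
typer's directory `Rank1Residual/P2/`, Theses-free, no item): port **P62 (part 3b: PART M §D–§E)** of STUB-PLAN
`stub_heegnerIndexLowerAtTwo` v8.1 (crux `PrintCf2.SplitBadTwoLowerHalfOfFacts`, stmt-BirchSwinnertonDyer-27851; `CRITIC-ROWS-g46.md` row
132 = **R227 «THE SEAM MODULO LEVEL n»**; sketch k1-g43 `c394c15f3c926eba` PART M §D (ll. 1749–1864) and §E (ll. 1866–2035), over
part 3a `PrintCf2SplitBadTwoDeltaReadCore.lean` (§C: `readingValue_eq_half_sub`), part 1 `SeamModLevel` and the tree's ports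
P47/P52/P53 (`ReadTwoCut.RamifiedReading`, `LocalUntwist`, `ShiftLift.refl_table_charSum`); the sketch's binder `hθlt` is REPLACED
by `hθc : Continuous θ` (critic certificate `critic_g46_hthetalt.lean`), the sketch's hypothesis `hex : LocalUntwistExists …` of E7
is DISCHARGED by the tree's theorem `LocalUntwist.localUntwistExists` (P52)).  HONEST FRAMING: road-B′ construction plumbing
below the receptacle (weight 0 in the critic's Heegner-weight test); nothing here proves BSD, the crux, the stub or HARDEST (a)/(b);
no named fact, no `sorry`.  The `Prop`-valued `def`s `IsReflectingFamily`, `SeamModLevel`, `ValueIdentification`, `PacketMatching`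
are receptacles with explicit binders (typed nodes of the junction, nothing asserted); `PacketMatching` (E6) is the ONE remaining
typed input of the (γ′) ⊕ (δ) node (critic: XS–S, tree-assemblable from `evalPt₁_hom_compSeries_eq_zero`,
`exists_algClosureToC_eq_of_aeval_eq_zero`, `exists_unit_ltAct_genPt_eq`, `mapPt_relGalOfUnit_relAct`, `cohPt_eq`) and is NOT
proved in this file.

* §D (δ) ASSEMBLED: `IsReflectingFamily`, `exists_isReflectingFamily`, ★★★ `delta_read₂`, `delta_read₂_series`, ★ `delta_charSum`,
  `delta_charSum_indep`.
* §E what remains of (γ′), typed: `SeamModLevel` (E1), `delta_read₂_of_seamModLevel`, `untwistedLogTable` (E2), `ValueIdentification`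
  (E3), ★ `seamModLevel_of_valueIdentification` (E4), ★ `coe_evS_gC_eq` (E5, transport), `PacketMatching` (E6, typed),
  ★ `valueIdentification_of_packetMatching` (E7).

References: stub-critic `CRITIC-ROWS-g46.md` row 132, `critic_g46_hthetalt.lean`; [deShalit1987] I.3.2 (5), (7) (p. 17), I.3.3 (7)–(8),
I §2.2 Theorem (p. 13), (p. 21–22); [Lang1990CyclotomicFields] Ch. 7, CW 1–2 (p. 130).
-/

noncomputable section

open scoped PowerSeries.WithPiTopology

namespace Summit.BirchSwinnertonDyer.Rank1Residual.P2.DeltaRead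

/-- `ζ^m = ζ^{m mod N}` when `ζ^N = 1`. -/
private theorem pow_eq_pow_mod_of_pow_eq_one' {K : Type*} [Monoid K] {ζ : K} {N : ℕ} (hζ : ζ ^ N = 1) (m : ℕ) :
    ζ ^ m = ζ ^ (m % N) := by
  conv_lhs => rw [← Nat.mod_add_div m N, pow_add, pow_mul, hζ, one_pow, mul_one]

section Witness

open ValuativeRel IsLocalRing Field
open Literature.NumberTheory.Transcendental
open Literature.NumberTheory.GaloisRepresentations Literature.NumberTheory.GaloisRepresentations.IsNonarchimedeanLocalField
  Literature.NumberTheory.GaloisRepresentations.LubinTate Literature.NumberTheory.PAdicHodge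
  Literature.NumberTheory.EllipticCurves
open InstTwoCore (thetaBar constantCoeff_thetaBar reflQuotC reflQuotN gaugeUnit gaugeConst)
open SeamModLevel

variable {F : Type} [Field F] [ValuativeRel F] [TopologicalSpace F] [IsNonarchimedeanLocalField F]

attribute [local instance] ltNormUniformSpace ltNormIsUniformAddGroup rk1 nF nE fintypeResidueField

variable (hq : residueFieldCard F = 2) (h2 : (valuation F).IsUniformizer (((2 : ℕ) : 𝒪[F]) : F)) (u : 𝒪[F]ˣ)
variable (E : IntermediateField F (AlgebraicClosure F)) [FiniteDimensional F E] [Normal F E] [IsGalois F E]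
  (hE : E ≤ maxUnramified F) {σ₀ : absoluteGaloisGroup F} (hσ₀ : IsAbsArithFrob σ₀)
variable {ε : (maxUnramifiedCompletion F)ˣ}
  (hε : maxUnramifiedCompletion.galAut F σ₀ (ε : maxUnramifiedCompletion F) =
    algebraMap 𝒪[F] (maxUnramifiedCompletion F) (u : 𝒪[F]) * (ε : maxUnramifiedCompletion F))
variable (θ : CompletedAlgClosure F →+* ℂ_[2]) (hθc : Continuous θ)
  (hθ1 : ∀ z : CBall F, ‖θ (z : CompletedAlgClosure F)‖ ≤ 1)

/-! ### §D  (δ) ASSEMBLED on a reflecting torsion family, modulo the seam-mod-level-`n`. -/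

/-- A `Ĝ_m`-REFLECTING family indexed by `ℤ/2^{n+1}`: `1 + z_{a+2^n} = −(1 + z_a)` (e.g. `z_a = ζ^a − 1`). -/
def IsReflectingFamily (n : ℕ) (z : ZMod (2 ^ (n + 1)) → (maxNilIdealC F).toIdeal) : Prop :=
  ∀ a : ZMod (2 ^ (n + 1)),
    ((z (a + 2 ^ n) : CBall F) : CompletedAlgClosure F) = -2 - ((z a : CBall F) : CompletedAlgClosure F)

include h2 in
/-- D2 ★ EXISTENCE: a root of unity `ζ ∈ ℂ_F` with `ζ^{2^n} = −1` gives the reflecting family `z_a := ζ^a − 1`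
(`‖ζ^a − 1‖ < 1` by the tree's `norm_sub_one_lt_one_of_pow_two_pow_eq_one`). -/
theorem exists_isReflectingFamily (n : ℕ) {ζ : CompletedAlgClosure F} (hζ : ζ ^ 2 ^ n = -1) :
    ∃ z : ZMod (2 ^ (n + 1)) → (maxNilIdealC F).toIdeal, IsReflectingFamily n z ∧
      ∀ a, ((z a : CBall F) : CompletedAlgClosure F) = ζ ^ (a : ZMod (2 ^ (n + 1))).val - 1 := by
  have hζ2 : ζ ^ 2 ^ (n + 1) = 1 := by rw [pow_succ, pow_mul, hζ]; norm_num
  have hlt : ∀ k : ℕ, ‖ζ ^ k - 1‖ < 1 := fun k =>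
    LubinTate.norm_sub_one_lt_one_of_pow_two_pow_eq_one (n := n + 1) (norm_two_lt_one_C h2)
      (by rw [← pow_mul, mul_comm, pow_mul, hζ2, one_pow])
  choose z hz using fun a : ZMod (2 ^ (n + 1)) => exists_pt_coe_eq (F := F) (hlt a.val)
  refine ⟨z, fun a => ?_, hz⟩
  rw [hz, hz]
  have h2n : (2 ^ n : ZMod (2 ^ (n + 1))).val = 2 ^ n := by
    rw [show (2 ^ n : ZMod (2 ^ (n + 1))) = ((2 ^ n : ℕ) : ZMod (2 ^ (n + 1))) by norm_cast, ZMod.val_natCast]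
    exact Nat.mod_eq_of_lt (Nat.pow_lt_pow_right (by norm_num) (Nat.lt_succ_self n))
  have hval : (a + 2 ^ n : ZMod (2 ^ (n + 1))).val = (a.val + 2 ^ n) % 2 ^ (n + 1) := by
    rw [ZMod.val_add, h2n]
  rw [hval, ← pow_eq_pow_mod_of_pow_eq_one' hζ2, pow_add, hζ]
  ring

include hq hθc hθ1 in
/-- D3 ★★★ **(δ), MODULO THE SEAM-MOD-LEVEL-n.**  For `n ≥ 1`, any reflecting torsion family `z`, any relative
norm-coherent unit `β`, and ANY table `T` on `(ℤ/2^{n+1})ˣ` congruent to `Lg_β ∘ z` modulo a `γ₀`-periodic table `C`: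
k3-g38's `RamifiedReading` holds with `V = V_β ∘ z` (the reading witness's values), `V₁ = V − c_β`, `V₂ = −c_β`,
`e = refl`, `ℓ γ = ½·(T γ − T(γ·γ₀))`.  This is `read₂_of_refl_cut` INSTANTIATED (critic (δ)) — with the seam in
its weakest form. -/
theorem delta_read₂ (n : ℕ) (hn : 1 ≤ n) (β : RelNormCoherentUnits (isUniformizer_unit_mul h2 u) E)
    (z : ZMod (2 ^ (n + 1)) → (maxNilIdealC F).toIdeal) (hz : IsReflectingFamily n z)
    (T C : (ZMod (2 ^ (n + 1)))ˣ → ℂ_[2]) (hC : ∀ γ, C (γ * shiftUnit n hn) = C γ)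
    (hseam : ∀ γ : (ZMod (2 ^ (n + 1)))ˣ,
      Lg hq h2 u E hE hσ₀ hε θ β (z (γ : ZMod (2 ^ (n + 1)))) = T γ + C γ) :
    ReadTwoCut.RamifiedReading (pow_dvd_pow 2 (Nat.le_succ n))
      (fun a => readingValue hq h2 u E hE hσ₀ hε θ β (z a))
      (fun a => readingValue hq h2 u E hE hσ₀ hε θ β (z a) + -gaugeConst hq h2 u E hE hσ₀ θ β)
      (fun _ : ZMod (2 ^ n) => -gaugeConst hq h2 u E hE hσ₀ θ β) (Equiv.refl _)
      (fun γ => 2⁻¹ * (T γ - T (γ * shiftUnit n hn))) :=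
  read₂_of_refl_cut_of_seam_mod_periodic _ (Equiv.refl _) _ (fun a => Lg hq h2 u E hE hσ₀ hε θ β (z a)) T 2⁻¹ _
    (2 ^ n) (shiftUnit n hn) C hC (fun γ => coe_mul_shiftUnit n hn γ)
    (fun γ => readingValue_eq_half_sub hq h2 u E hE hσ₀ hε θ hθc hθ1 β (z γ) (z (γ + 2 ^ n)) (hz γ)) hseam

include hq hθc hθ1 in
/-- D3′ ★★★ **(δ) FOR THE READING SERIES ITSELF**: there is ONE integral series `R = (L∘y)∘ϑ̄ ∈ 𝒪_ℂ⟦S⟧` (the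
reading witness of record, k3-g40/J10 currency) whose `θ`-VALUES `a ↦ Σ_m θ([S^m]R)·θ(z_a)^m` at the torsion family
satisfy k3-g38's `RamifiedReading` with the REFL unit table `½·(T γ − T(γγ₀))`, for any `T ≡ Lg_β∘z (mod level n)`. -/
theorem delta_read₂_series (n : ℕ) (hn : 1 ≤ n)
    (β : RelNormCoherentUnits (isUniformizer_unit_mul h2 u) E)
    (z : ZMod (2 ^ (n + 1)) → (maxNilIdealC F).toIdeal) (hz : IsReflectingFamily n z)
    (T C : (ZMod (2 ^ (n + 1)))ˣ → ℂ_[2]) (hC : ∀ γ, C (γ * shiftUnit n hn) = C γ)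
    (hseam : ∀ γ : (ZMod (2 ^ (n + 1)))ˣ,
      Lg hq h2 u E hE hσ₀ hε θ β (z (γ : ZMod (2 ^ (n + 1)))) = T γ + C γ) :
    ∃ L y : PowerSeries (CBall F), PowerSeries.constantCoeff y = 0 ∧
      reflQuotN hq h2 u E hE hσ₀ β = 1 + PowerSeries.C (2 : CBall F) * y ∧
      θ ((PowerSeries.coeff 0 L : CBall F) : CompletedAlgClosure F) = 0 ∧
      ReadTwoCut.RamifiedReading (pow_dvd_pow 2 (Nat.le_succ n))
        (fun a => ∑' m : ℕ, PowerSeries.coeff m (PowerSeries.map (θ.comp (CBall F).subtype)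
            (PowerSeries.subst (thetaBar h2 u hσ₀ hε) (PowerSeries.subst y L))) *
            (θ ((z a : CBall F) : CompletedAlgClosure F)) ^ m)
        (fun a => (∑' m : ℕ, PowerSeries.coeff m (PowerSeries.map (θ.comp (CBall F).subtype)
            (PowerSeries.subst (thetaBar h2 u hσ₀ hε) (PowerSeries.subst y L))) *
            (θ ((z a : CBall F) : CompletedAlgClosure F)) ^ m) + -gaugeConst hq h2 u E hE hσ₀ θ β)
        (fun _ : ZMod (2 ^ n) => -gaugeConst hq h2 u E hE hσ₀ θ β) (Equiv.refl _)
        (fun γ => 2⁻¹ * (T γ - T (γ * shiftUnit n hn))) := by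
  obtain ⟨L, y, hy0, hPy, hL0, hval⟩ := inst₂_core_uniform hq h2 u E hE hσ₀ hε θ hθc hθ1 β
  refine ⟨L, y, hy0, hPy, hL0, ?_⟩
  have hval' : ∀ a : ZMod (2 ^ (n + 1)),
      ∑' m : ℕ, PowerSeries.coeff m (PowerSeries.map (θ.comp (CBall F).subtype)
          (PowerSeries.subst (thetaBar h2 u hσ₀ hε) (PowerSeries.subst y L))) *
          (θ ((z a : CBall F) : CompletedAlgClosure F)) ^ m =
        readingValue hq h2 u E hE hσ₀ hε θ β (z a) := fun a => hval (z a)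
  simp_rw [hval']
  exact delta_read₂ hq h2 u E hE hσ₀ hε θ hθc hθ1 n hn β z hz T C hC hseam

include hq hθc hθ1 in
/-- D4 ★ **WHAT THE CONSUMER SEES** (`ShiftLift.refl_table_charSum` ∘ D3): for every multiplicative character `ψ`
with `ψ(1 + 2^n) = −1` (= not factoring through level `n`, the only ones `atom_shape` is applied to), the `ψ`-sum of
the witness's unit values is `Σ_γ ψ(γ)·T(γ)` — for ANY `T ≡ Lg_β ∘ z (mod level-n tables)`.  The periodic ambiguity
of the seam has dropped out. -/
theorem delta_charSum (n : ℕ) (hn : 1 ≤ n) (β : RelNormCoherentUnits (isUniformizer_unit_mul h2 u) E)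
    (z : ZMod (2 ^ (n + 1)) → (maxNilIdealC F).toIdeal) (hz : IsReflectingFamily n z)
    (T C : (ZMod (2 ^ (n + 1)))ˣ → ℂ_[2]) (hC : ∀ γ, C (γ * shiftUnit n hn) = C γ)
    (hseam : ∀ γ : (ZMod (2 ^ (n + 1)))ˣ,
      Lg hq h2 u E hE hσ₀ hε θ β (z (γ : ZMod (2 ^ (n + 1)))) = T γ + C γ)
    (ψ : MulChar (ZMod (2 ^ (n + 1))) ℂ_[2]) (hψ : ψ ((shiftUnit n hn : (ZMod (2 ^ (n + 1)))ˣ) : ZMod _) = -1) :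
    ∑ γ : (ZMod (2 ^ (n + 1)))ˣ, ψ (γ : ZMod (2 ^ (n + 1))) *
        (readingValue hq h2 u E hE hσ₀ hε θ β (z γ) + -gaugeConst hq h2 u E hE hσ₀ θ β) =
      ∑ γ : (ZMod (2 ^ (n + 1)))ˣ, ψ (γ : ZMod (2 ^ (n + 1))) * T γ := by
  have hread := delta_read₂ hq h2 u E hE hσ₀ hε θ hθc hθ1 n hn β z hz T C hC hseam
  have h1 : ∀ γ : (ZMod (2 ^ (n + 1)))ˣ,
      readingValue hq h2 u E hE hσ₀ hε θ β (z γ) + -gaugeConst hq h2 u E hE hσ₀ θ β =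
        2⁻¹ * (T γ - T (γ * shiftUnit n hn)) := fun γ => hread.2 γ
  simp_rw [h1]
  have key := ShiftLift.refl_table_charSum (MulEquiv.refl _) ψ T 2⁻¹ (shiftUnit n hn) (shiftUnit_mul_self n hn) hψ
  simp only [MulEquiv.refl_apply] at key
  rw [key, mul_inv_cancel₀ (two_ne_zero : (2 : ℂ_[2]) ≠ 0), one_mul]

/-- D4′. The same number from the EXACT seam (`C = 0`): the two readings agree — the consumer cannot tell them apart. -/
theorem delta_charSum_indep (n : ℕ) (hn : 1 ≤ n) (T C : (ZMod (2 ^ (n + 1)))ˣ → ℂ_[2])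
    (hC : ∀ γ, C (γ * shiftUnit n hn) = C γ)
    (ψ : MulChar (ZMod (2 ^ (n + 1))) ℂ_[2]) (hψ : ψ ((shiftUnit n hn : (ZMod (2 ^ (n + 1)))ˣ) : ZMod _) = -1) :
    ∑ γ : (ZMod (2 ^ (n + 1)))ˣ, ψ (γ : ZMod (2 ^ (n + 1))) * (T γ + C γ) =
      ∑ γ : (ZMod (2 ^ (n + 1)))ˣ, ψ (γ : ZMod (2 ^ (n + 1))) * T γ :=
  sum_mul_add_periodic (Γ := (ZMod (2 ^ (n + 1)))ˣ) (two_ne_zero : (2 : ℂ_[2]) ≠ 0)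
    (fun γ : (ZMod (2 ^ (n + 1)))ˣ => ψ (γ : ZMod (2 ^ (n + 1)))) T C (shiftUnit n hn)
    (fun γ => by
      show ψ ((γ * shiftUnit n hn : (ZMod (2 ^ (n + 1)))ˣ) : ZMod _) = -ψ (γ : ZMod _)
      rw [Units.val_mul, map_mul, hψ, mul_neg, mul_one]) hC

/-! ### §E  WHAT REMAINS of (γ′) — TYPED.  E1–E3, E6 are STATEMENTS (Props / a table), E4, E5, E7 are PROVED
reductions: the seam-mod-level-`n` (E1) follows with `C = 0` from the VALUE IDENTIFICATION (E3)
`ι(τ_γ β_n) = ḡ_β(ϑ̄ z_γ)`, which follows from `LocalUntwist.LocalUntwistExists` (PROVED in the tree: `LocalUntwist.localUntwistExists`, P52) and the ONE remaining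
input **E6 `PacketMatching`**: `ϑ̄(z_γ) = ι(σ_{v_γ} ω_{n+1})` in `𝒪_ℂ` (the comparison isomorphism carries the
`Ĝ_m`-packet to de Shalit's coherent Lubin–Tate packet).  Nothing in §E is the stub or the crux. -/

open LocalUntwist (ActsAsFrobPow LocalUntwistExists exists_untwisted_table)

/-- E1. THE REMAINING OBLIGATION of (γ′) after §A–§D, as a Prop: the seam MODULO LEVEL `n` for a unit table `T`. -/
def SeamModLevel (n : ℕ) (hn : 1 ≤ n) (β : RelNormCoherentUnits (isUniformizer_unit_mul h2 u) E)
    (z : ZMod (2 ^ (n + 1)) → (maxNilIdealC F).toIdeal) (T : (ZMod (2 ^ (n + 1)))ˣ → ℂ_[2]) : Prop :=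
  ∃ C : (ZMod (2 ^ (n + 1)))ˣ → ℂ_[2], (∀ γ, C (γ * shiftUnit n hn) = C γ) ∧
    ∀ γ : (ZMod (2 ^ (n + 1)))ˣ, Lg hq h2 u E hE hσ₀ hε θ β (z (γ : ZMod (2 ^ (n + 1)))) = T γ + C γ

include hq hθc hθ1 in
/-- E1′ (PROVED, = D3 repackaged): `SeamModLevel` is exactly what (δ) consumes. -/
theorem delta_read₂_of_seamModLevel (n : ℕ) (hn : 1 ≤ n)
    (β : RelNormCoherentUnits (isUniformizer_unit_mul h2 u) E)
    (z : ZMod (2 ^ (n + 1)) → (maxNilIdealC F).toIdeal) (hz : IsReflectingFamily n z)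
    (T : (ZMod (2 ^ (n + 1)))ˣ → ℂ_[2]) (hT : SeamModLevel hq h2 u E hE hσ₀ hε θ n hn β z T) :
    ReadTwoCut.RamifiedReading (pow_dvd_pow 2 (Nat.le_succ n))
      (fun a => readingValue hq h2 u E hE hσ₀ hε θ β (z a))
      (fun a => readingValue hq h2 u E hE hσ₀ hε θ β (z a) + -gaugeConst hq h2 u E hE hσ₀ θ β)
      (fun _ : ZMod (2 ^ n) => -gaugeConst hq h2 u E hE hσ₀ θ β) (Equiv.refl _)
      (fun γ => 2⁻¹ * (T γ - T (γ * shiftUnit n hn))) := by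
  obtain ⟨C, hC, hseam⟩ := hT
  exact delta_read₂ hq h2 u E hE hσ₀ hε θ hθc hθ1 n hn β z hz T C hC hseam

/-- E2. THE TARGET TABLE of record: `T γ := plog (c · θ ι(τ_γ β_n))` — the `ℂ₂`-images (tree `algClosureToC`, then
`θ`) of the Galois conjugates `τ_γ(β_n)` of the level-`n` component of the norm-coherent unit, `τ_γ` the untwisting
automorphisms of k3-g40 `exists_untwisted_table` (`k = 0`), `c` ONE principal-normalising constant. -/
def untwistedLogTable {π : 𝒪[F]} {hπ : (valuation F).IsUniformizer (π : F)} (n : ℕ)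
    (β : RelNormCoherentUnits hπ E) (c : ℂ_[2])
    (τ : (ZMod (2 ^ (n + 1)))ˣ → ((E ⊔ ltField π n : IntermediateField F (AlgebraicClosure F)) ≃ₐ[F]
      (E ⊔ ltField π n : IntermediateField F (AlgebraicClosure F)))) :
    (ZMod (2 ^ (n + 1)))ˣ → ℂ_[2] := fun γ =>
  PadicExp.plog (c * θ (algClosureToC F
    ((τ γ ((β.val n : unitBall (E ⊔ ltField π n : IntermediateField F (AlgebraicClosure F))) :
        (E ⊔ ltField π n : IntermediateField F (AlgebraicClosure F))) :
      (E ⊔ ltField π n : IntermediateField F (AlgebraicClosure F))) : AlgebraicClosure F)))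

/-- E3. **VALUE IDENTIFICATION** (statement): the `ℂ_F`-value of `ḡ_β` at `ϑ̄(z_γ)` is the image of the Galois
conjugate `τ_γ(β_n)` (de Shalit I §2.2 Theorem + the local untwist; Lang, *Cyclotomic Fields* I–II, Ch. 7, CW 2 in the
`Ĝ_m` model). -/
def ValueIdentification (n : ℕ) (β : RelNormCoherentUnits (isUniformizer_unit_mul h2 u) E)
    (z : ZMod (2 ^ (n + 1)) → (maxNilIdealC F).toIdeal)
    (τ : (ZMod (2 ^ (n + 1)))ˣ →
      ((E ⊔ ltField ((u : 𝒪[F]) * ((2 : ℕ) : 𝒪[F])) n : IntermediateField F (AlgebraicClosure F)) ≃ₐ[F]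
        (E ⊔ ltField ((u : 𝒪[F]) * ((2 : ℕ) : 𝒪[F])) n : IntermediateField F (AlgebraicClosure F)))) : Prop :=
  ∀ γ : (ZMod (2 ^ (n + 1)))ˣ,
    algClosureToC F
        ((τ γ ((β.val n : unitBall (E ⊔ ltField ((u : 𝒪[F]) * ((2 : ℕ) : 𝒪[F])) n :
              IntermediateField F (AlgebraicClosure F))) :
            (E ⊔ ltField ((u : 𝒪[F]) * ((2 : ℕ) : 𝒪[F])) n : IntermediateField F (AlgebraicClosure F))) :
          (E ⊔ ltField ((u : 𝒪[F]) * ((2 : ℕ) : 𝒪[F])) n : IntermediateField F (AlgebraicClosure F))) :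
          AlgebraicClosure F) =
      ((evS (maxNilIdealC F) (thetaPt h2 u hσ₀ hε (z (γ : ZMod (2 ^ (n + 1))))) (gC hq h2 u E hE hσ₀ β) :
        CBall F) : CompletedAlgClosure F)

/-- E4 ★ PROVED: VALUE IDENTIFICATION ⟹ the seam-mod-level-`n` for the untwisted log table, with `C = 0` and the
principal-normalising constant `c = θ(ḡ_β(0)⁻¹)`. -/
theorem seamModLevel_of_valueIdentification (n : ℕ) (hn : 1 ≤ n)
    (β : RelNormCoherentUnits (isUniformizer_unit_mul h2 u) E)
    (z : ZMod (2 ^ (n + 1)) → (maxNilIdealC F).toIdeal)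
    (τ : (ZMod (2 ^ (n + 1)))ˣ →
      ((E ⊔ ltField ((u : 𝒪[F]) * ((2 : ℕ) : 𝒪[F])) n : IntermediateField F (AlgebraicClosure F)) ≃ₐ[F]
        (E ⊔ ltField ((u : 𝒪[F]) * ((2 : ℕ) : 𝒪[F])) n : IntermediateField F (AlgebraicClosure F))))
    (hV : ValueIdentification hq h2 u E hE hσ₀ hε n β z τ) :
    SeamModLevel hq h2 u E hE hσ₀ hε θ n hn β z
      (untwistedLogTable E θ n β
        (θ (((↑(baseUnit hq h2 u E hE hσ₀ β)⁻¹ : CBall F)) : CompletedAlgClosure F)) τ) := by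
  refine ⟨fun _ => 0, fun _ => rfl, fun γ => ?_⟩
  simp only [Lg, untwistedLogTable, add_zero, evS_subst_thetaBar, gN, map_mul, evS_C, Subring.coe_mul]
  rw [hV γ]

/-- E5 ★ PROVED (transport, tree `map_evS`): the `ℂ_F`-value of `ḡ_β` at the image of an algebraic point `y` of
`𝔪_{E·F_π^{n+1}}` is the image of the algebraic value `(ι g_β)(y)`. -/
theorem coe_evS_gC_eq (n : ℕ) (β : RelNormCoherentUnits (isUniformizer_unit_mul h2 u) E)
    (y : (maxNilIdeal F (E ⊔ ltField ((u : 𝒪[F]) * ((2 : ℕ) : 𝒪[F])) n :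
      IntermediateField F (AlgebraicClosure F))).toIdeal)
    (pt : (maxNilIdealC F).toIdeal)
    (hpt : (pt : CBall F) =
      unitBallToCBall (E ⊔ ltField ((u : 𝒪[F]) * ((2 : ℕ) : 𝒪[F])) n : IntermediateField F (AlgebraicClosure F))
        (y : unitBall (E ⊔ ltField ((u : 𝒪[F]) * ((2 : ℕ) : 𝒪[F])) n :
          IntermediateField F (AlgebraicClosure F)))) :
    ((evS (maxNilIdealC F) pt (gC hq h2 u E hE hσ₀ β) : CBall F) : CompletedAlgClosure F) =
      algClosureToC F
        (((evS (maxNilIdeal F (E ⊔ ltField ((u : 𝒪[F]) * ((2 : ℕ) : 𝒪[F])) n :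
              IntermediateField F (AlgebraicClosure F))) y
            (PowerSeries.map (inclUnitBall (F := F)
                (le_sup_left : E ≤ E ⊔ ltField ((u : 𝒪[F]) * ((2 : ℕ) : 𝒪[F])) n) :
              unitBall E →+* unitBall (E ⊔ ltField ((u : 𝒪[F]) * ((2 : ℕ) : 𝒪[F])) n :
                IntermediateField F (AlgebraicClosure F)))
              (relColemanSeries (isUniformizer_unit_mul h2 u) E hq hE hσ₀ β)) :
            unitBall (E ⊔ ltField ((u : 𝒪[F]) * ((2 : ℕ) : 𝒪[F])) n :
              IntermediateField F (AlgebraicClosure F))) :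
          (E ⊔ ltField ((u : 𝒪[F]) * ((2 : ℕ) : 𝒪[F])) n : IntermediateField F (AlgebraicClosure F))) :
          AlgebraicClosure F) := by
  have hy : unitBallToCBall (E ⊔ ltField ((u : 𝒪[F]) * ((2 : ℕ) : 𝒪[F])) n :
        IntermediateField F (AlgebraicClosure F))
      (y : unitBall (E ⊔ ltField ((u : 𝒪[F]) * ((2 : ℕ) : 𝒪[F])) n :
        IntermediateField F (AlgebraicClosure F))) ∈ (maxNilIdealC F).toIdeal := by
    rw [← hpt]; exact pt.2
  have key := map_evS
    (maxNilIdeal F (E ⊔ ltField ((u : 𝒪[F]) * ((2 : ℕ) : 𝒪[F])) n : IntermediateField F (AlgebraicClosure F)))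
    (maxNilIdealC F)
    (unitBallToCBall (E ⊔ ltField ((u : 𝒪[F]) * ((2 : ℕ) : 𝒪[F])) n :
      IntermediateField F (AlgebraicClosure F)))
    (continuous_unitBallToCBall (F := F)
      (E := (E ⊔ ltField ((u : 𝒪[F]) * ((2 : ℕ) : 𝒪[F])) n : IntermediateField F (AlgebraicClosure F))))
    y hy
    (PowerSeries.map (inclUnitBall (F := F)
        (le_sup_left : E ≤ E ⊔ ltField ((u : 𝒪[F]) * ((2 : ℕ) : 𝒪[F])) n) :
      unitBall E →+* unitBall (E ⊔ ltField ((u : 𝒪[F]) * ((2 : ℕ) : 𝒪[F])) n :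
        IntermediateField F (AlgebraicClosure F)))
      (relColemanSeries (isUniformizer_unit_mul h2 u) E hq hE hσ₀ β))
  have hpt' : pt = ⟨_, hy⟩ := Subtype.ext hpt
  have hcomp : (unitBallToCBall (F := F) (E ⊔ ltField ((u : 𝒪[F]) * ((2 : ℕ) : 𝒪[F])) n :
        IntermediateField F (AlgebraicClosure F))).comp
      (inclUnitBall (F := F) (le_sup_left : E ≤ E ⊔ ltField ((u : 𝒪[F]) * ((2 : ℕ) : 𝒪[F])) n) :
        unitBall E →+* unitBall (E ⊔ ltField ((u : 𝒪[F]) * ((2 : ℕ) : 𝒪[F])) n :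
          IntermediateField F (AlgebraicClosure F))) = unitBallToCBall (F := F) E :=
    RingHom.ext fun x => Subtype.ext rfl
  have hmap : PowerSeries.map (unitBallToCBall (E ⊔ ltField ((u : 𝒪[F]) * ((2 : ℕ) : 𝒪[F])) n :
        IntermediateField F (AlgebraicClosure F)))
      (PowerSeries.map (inclUnitBall (F := F)
          (le_sup_left : E ≤ E ⊔ ltField ((u : 𝒪[F]) * ((2 : ℕ) : 𝒪[F])) n) :
        unitBall E →+* unitBall (E ⊔ ltField ((u : 𝒪[F]) * ((2 : ℕ) : 𝒪[F])) n :
          IntermediateField F (AlgebraicClosure F)))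
        (relColemanSeries (isUniformizer_unit_mul h2 u) E hq hE hσ₀ β)) = gC hq h2 u E hE hσ₀ β := by
    rw [← RingHom.comp_apply (PowerSeries.map _) (PowerSeries.map _), ← PowerSeries.map_comp, hcomp]; rfl
  rw [hpt', ← hmap, ← key]
  rfl

/-- E6 ★ **THE ONE REMAINING INPUT of the (γ′)+(δ) node, typed — TORSION-PACKET MATCHING** (statement only; NOT
proved here): the `Ĝ_m`-side evaluation points `ϑ̄(z_γ)` ARE (the `𝒪_ℂ`-images of) the Galois translates
`σ_{v_γ}(ι ω_{n+1})` of de Shalit's coherent torsion point of level `n+1`, for some assignment `v : (ℤ/2^{n+1})ˣ → 𝒪_F^×`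
(the comparison isomorphism `ϑ : Ĝ_m ≅ F_{u·2}` over `𝒪_{F̂^nr}` carries `ζ^a − 1 ↦ [a]_{F}(ω)`; k1-g41 J4 /
critic (γ); size S).  With E5/E7 and k3-g40 `LocalUntwistExists` this gives E3, hence E1 with `C = 0` (E4), hence (δ). -/
def PacketMatching (n : ℕ) (z : ZMod (2 ^ (n + 1)) → (maxNilIdealC F).toIdeal)
    (v : (ZMod (2 ^ (n + 1)))ˣ → 𝒪[F]ˣ) : Prop :=
  ∀ γ : (ZMod (2 ^ (n + 1)))ˣ,
    ((thetaPt h2 u hσ₀ hε (z (γ : ZMod (2 ^ (n + 1)))) : CBall F) =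
      unitBallToCBall (E ⊔ ltField ((u : 𝒪[F]) * ((2 : ℕ) : 𝒪[F])) n : IntermediateField F (AlgebraicClosure F))
        ((mapPt (relGalOfUnit (isUniformizer_unit_mul h2 u) E n hE (v γ))
          (inclPt (le_sup_right : ltField ((u : 𝒪[F]) * ((2 : ℕ) : 𝒪[F])) n ≤
              E ⊔ ltField ((u : 𝒪[F]) * ((2 : ℕ) : 𝒪[F])) n)
            (cohPt (isUniformizer_unit_mul h2 u) n))) :
          unitBall (E ⊔ ltField ((u : 𝒪[F]) * ((2 : ℕ) : 𝒪[F])) n : IntermediateField F (AlgebraicClosure F))))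

/-- E7 ★ PROVED: PACKET MATCHING ⟹ VALUE IDENTIFICATION (the local untwist is the tree's theorem `LocalUntwist.localUntwistExists`) with untwisting
automorphisms acting on `𝒪_E` as `φ^{n+1}` (tree `evS_relColemanSeries` + k3-g40 `exists_untwisted_table`, `k = 0`,
+ E5). -/
theorem valueIdentification_of_packetMatching (n : ℕ) (β : RelNormCoherentUnits (isUniformizer_unit_mul h2 u) E)
    (z : ZMod (2 ^ (n + 1)) → (maxNilIdealC F).toIdeal) (v : (ZMod (2 ^ (n + 1)))ˣ → 𝒪[F]ˣ)
    (hP : PacketMatching h2 u E hE hσ₀ hε n z v) :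
    ∃ τ : (ZMod (2 ^ (n + 1)))ˣ →
        ((E ⊔ ltField ((u : 𝒪[F]) * ((2 : ℕ) : 𝒪[F])) n : IntermediateField F (AlgebraicClosure F)) ≃ₐ[F]
          (E ⊔ ltField ((u : 𝒪[F]) * ((2 : ℕ) : 𝒪[F])) n : IntermediateField F (AlgebraicClosure F))),
      (∀ γ, ActsAsFrobPow E σ₀ (n + 1) (τ γ)) ∧ ValueIdentification hq h2 u E hE hσ₀ hε n β z τ := by
  have H := fun γ : (ZMod (2 ^ (n + 1)))ˣ =>
    exists_untwisted_table (isUniformizer_unit_mul h2 u) E hE σ₀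
      (relColemanSeries (isUniformizer_unit_mul h2 u) E hq hE hσ₀ β) n 0 (β.val n)
      (evS_relColemanSeries (isUniformizer_unit_mul h2 u) E hq hE hσ₀ β n) (v γ)
  choose τ hτ hval using H
  refine ⟨τ, fun γ => by simpa using hτ γ, fun γ => ?_⟩
  rw [← hval γ]
  simp only [Function.iterate_zero, id_eq]
  exact (coe_evS_gC_eq hq h2 u E hE hσ₀ n β _ _ (hP γ)).symm

end Witness

end Summit.BirchSwinnertonDyer.Rank1Residual.P2.DeltaRead

end
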